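import Literature.InformationTheory.QuantumCodes.CSSDistanceHardness
import Literature.InformationTheory.QuantumCodes.SyndromeDecodingAdditive
import HarnessLib

/-!
# Quantum syndrome decoding is NP-hard: COSET GENERALIZED WEIGHTS (Fujita 2012; Kuo–Lu 2020) — PROVED

The decision problem behind minimum-weight (bounded-distance) decoding of a stabilizer code from its
CHECK MATRIX and a SYNDROME, as a language over `{0,1}` in the tree's complexity vocabulary, and its
NP-hardness as KERNEL theorems (no named fact).

Kuo–Lu [KuoLu2020, §3] (read on the page, held text `paper:arxiv-1306.5173`, chunk p0005 L118–134):

> «Coset Generalized Weights (CGW). Input: An `m × 2n` binary matrix `H` satisfying `H Λ Hᵀ = O`, a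
> binary vector `s ∈ 𝔽₂^m`, and an integer `t ≥ 0`. Question: There exists a binary vector
> `e ∈ 𝔽₂^{2n}` satisfying `gw(e) ≤ t` and `e Λ Hᵀ = s`.»
> «Fujita also considered this decision problem and showed that it is NP-complete in Lemma 2 of
> [Fujita12]. For convenience, we restate the result as Theorem. CGW is NP-complete, even if
> `H = [H_X|O]` or `H = [O|H_Z]`.»

Here (§2, chunk p0004 L96–145) `Λ = [O I; I O]`, so `e Λ Hᵀ` is the vector of SYMPLECTIC inner
products of `e = (x|z)` with the rows of `H` — the error syndrome, the tree's `sympSyndrome` of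
`SyndromeDecodingAdditive.lean` — and `gw(x|z) = w_H(x) + w_H(z) − w_H(xz)` is the number of
non-identity tensor factors, the tree's `sympWeight` of `SymplecticCodes.lean`; `H Λ Hᵀ = O` says
that the rows pairwise commute (`IsSelfOrthogonal (rowSpan H)`, `MinimumDistanceHardness.lean`).
Kuo–Lu then restrict to `H = [O|H_Z]` (problem `CGW_Z`, p0005 L135–150), prove
`CGW_Z ≤ CGW_ZF` (full row rank; p0006 L8–68) and conclude «QBDD is NP-hard, even if `H = [H_X|O]`
or `H = [O|H_Z]`» (p0006 L71–73) for the FUNCTION problem QBDD (p0005 L57–66: output such an `e` or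
a failure indication).

What this file proves (KERNEL, no named fact):
* `CGW` — the language of COSET GENERALIZED WEIGHTS, instances `(⟨m, n, (H, s)⟩, t)` with `H` given
  by its `m` rows `(a|b) ∈ 𝔽₂ⁿ × 𝔽₂ⁿ`; `CGWZ` — its sub-language of instances with `H = [O|H_Z]`
  (every row of the form `(0|b)`), `CGWZ_le_CGW`.
* `SynDecHard.COSETWEIGHTS_karpReducible_CGWZ : COSETWEIGHTS ≤ₚ CGWZ` and
  `SynDecHard.COSETWEIGHTS_karpReducible_CGW : COSETWEIGHTS ≤ₚ CGW` — the reduction is the one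
  printed by Kuo–Lu (§3: `CGW_Z` «is» classical coset decoding): the COSET WEIGHTS instance
  `(A, y, w)` of Berlekamp–McEliece–van Tilborg [BerlekampMcelieceVantilborg1978, §III.A] («is there
  `x` with `wt(x) ≤ w` and `x A = y`») becomes the Z-type check matrix whose rows are `(0 | Aeⱼ)`
  (the columns of `A`), syndrome `y`, bound `min(w, m)` (`SynDecHard.zInst_mem_iff`).
* **`KuoLu2020_cosetGeneralizedWeightsZ_isNPHard : IsNPHard CGWZ`** and
  **`KuoLu2020_cosetGeneralizedWeights_isNPHard : IsNPHard CGW`** — the NP-HARDNESS half of the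
  printed theorem, including its clause «even if `H = [O|H_Z]`», from the tree's kernel theorem
  `BerlekampMcElieceVanTilborg1978_cosetWeights_isNPHard` (`Coding/DecodingHardness.lean`).

NOT in this file: NP-MEMBERSHIP of `CGW` (the other half of «NP-complete»; a verifier in the brick
algebra, sequel file); the `H = [H_X|O]` clause (symmetric; not restated); the FUNCTION problems QBDD /
QMLD / DQMLD of [KuoLu2020, §3–§4], [HsiehLegall2011, Main Theorem] («The problems QMLD and DQMLD are
both NP-hard», independent X–Z channel) and [IyerPoulin2015, Def. 4.1–4.2, Thm 5.1] (DQMLD is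
`#P`-complete) — the tree's `IsNPHard` is Karp-hardness of LANGUAGES and has no counting classes; they
are register entries only (qec `lit/LIT-4-REGISTER.md` §C5).

HONEST FRAMING (LADDER-QEC Q4/X1): this is the barrier sentence «minimum-weight decoding of a general
stabilizer code from (check matrix, syndrome) is NP-hard, already for Z-only checks» as a KERNEL
theorem; the census's certified decoder radii are per-code certificates, not an algorithm for this
problem. No novelty: statement and reduction are in print (Fujita 2012; Kuo–Lu 2012/2020).

## References

* [KuoLu2020] K.-Y. Kuo, C.-C. Lu, *On the hardnesses of several quantum decoding problems*, Quantum
  Inf. Process. 19 (2020) 123 = arXiv:1306.5173 (held: `paper:arxiv-1306.5173`), §2 (chunk p0004: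
  `Λ`, check matrix, `gw`), §3 (chunk p0005 L57–66 QBDD; L118–127 CGW; L129–134 Theorem «CGW is
  NP-complete, even if H = [H_X|O] or H = [O|H_Z]»; L135–150 CGW_Z / CGW_ZF; chunk p0006 L8–73).
* [Fujita2012] H. Fujita, *Quantum McEliece public-key cryptosystem*, Quantum Inf. Comput. 12 (2012)
  181–202, Lemma 2 — cited THROUGH Kuo–Lu's restatement (page not held).
* [HsiehLegall2011] M.-H. Hsieh, F. Le Gall, Phys. Rev. A 83 (2011) 052331 = arXiv:1009.1319 (held),
  Main Theorem (chunk p0006 L83–84).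
* [IyerPoulin2015] P. Iyer, D. Poulin, IEEE Trans. Inform. Theory 61 (2015) 5209–5223 =
  arXiv:1310.3235 (held), §4 Def. 4.1/4.2, §5 first paragraph («Consequently, QMLD ∈ NP-complete»,
  chunk p0012 L3) and Thm 5.1.
* [BerlekampMcelieceVantilborg1978] E. R. Berlekamp, R. J. McEliece, H. C. A. van Tilborg, IEEE
  Trans. Inform. Theory 24 (1978) 384–386, §III.A (COSET WEIGHTS).
* [AroraBarak2009] S. Arora, B. Barak, *Computational Complexity*, CUP 2009, §0.1, §1.3, Def. 2.7.

## Mathlib / tree search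

`rg 'Fujita|KuoLu|QBDD|CGW|HsiehLeGall|IyerPoulin|cosetGeneralized'` over
`Literature/InformationTheory`, `Literature/Computability`, `Summits/Ventures/QEC/Decoders` (2026-08-27):
no decision problem for quantum DECODING in the tree (only the distance problems `QMINDIST`,
`CSSMINDIST` and the classical `COSETWEIGHTS`, `MINDIST`, `SUBSPACEWEIGHTS`). Reused: the instance
plumbing of `CSSDistanceHardness.lean` / `CosetWeightsNPComplete.lean` (`Abits`, `ybits`,
`matOfBits`, `vecOfBits`, the guard `CosetWeightsNP.T`, `mhatF`/`nhatF`/`itemF`/`yvF`), `rowSpan`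
and `encodingSympRows`-style codes of `MinimumDistanceHardness.lean`, `sympSyndrome`
(`SyndromeDecodingAdditive.lean`), `sympWeight_mk_zero_snd`, `isSelfOrthogonal_span_range_iff`
(`StabilizerDistance.lean`).
-/

noncomputable section

namespace Literature.InformationTheory.QuantumCodes

open _root_.Computability Literature.Computability.Complexity Literature.InformationTheory.Coding
open scoped Literature.Computability.Complexity.Notation

/-! ### The language COSET GENERALIZED WEIGHTS -/

/-- Instances of CGW: `⟨m, n, (H, s)⟩` — a check matrix `H ∈ 𝔽₂^{m × 2n}` given by its `m` rows
`(a|b) ∈ 𝔽₂ⁿ × 𝔽₂ⁿ` and a syndrome `s ∈ 𝔽₂^m` — coded over `{0,1}` as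
`⟨bin m, ⟨bin n, ⟨[⟨a₀,b₀⟩, …], s⟩⟩⟩` (rows as in `encodingSympRows`, then the syndrome bits).
[cite: KuoLu2020, §3 (problem CGW, Input; arXiv:1306.5173 chunk p0005 L118–124)] -/
def encodingSyndInstance : Encoding (Σ m : ℕ, Σ n : ℕ, (Fin m → SympVec n) × (Fin m → ZMod 2)) Bool :=
  Encoding.sigmaBool fun m => Encoding.sigmaBool fun n =>
    (encodingFinVec ((encodingF2Vec n).pairBool (encodingF2Vec n)) m).pairBool (encodingF2Vec m)

/-- Yes-instances of COSET GENERALIZED WEIGHTS: `(⟨m, n, (H, s)⟩, t)` such that the rows of `H`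
pairwise commute (`H Λ Hᵀ = O`: the row span is self-orthogonal for the symplectic form — otherwise
`H` is no check matrix and the instance is a no-instance) and some `e ∈ 𝔽₂ⁿ × 𝔽₂ⁿ` has syndrome
`e Λ Hᵀ = s` (`sympSyndrome H e = s`) and generalized (= symplectic, Pauli) weight `gw(e) ≤ t`.
[cite: KuoLu2020, §3 (problem CGW, Question; chunk p0005 L118–127) with §2 (Λ, gw; chunk p0004 L96–138)] -/
def cosetGeneralizedWeightsSet : Set ((Σ m : ℕ, Σ n : ℕ, (Fin m → SympVec n) × (Fin m → ZMod 2)) × ℕ) :=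
  {p | IsSelfOrthogonal (rowSpan p.1.2.2.1) ∧
    ∃ e : SympVec p.1.2.1, sympSyndrome p.1.2.2.1 e = p.1.2.2.2 ∧ sympWeight e ≤ p.2}

/-- Unfolding lemma for `cosetGeneralizedWeightsSet`: Kuo–Lu's question verbatim (with the input
condition `H Λ Hᵀ = O` as part of the yes-set).
[cite: KuoLu2020, §3 (problem CGW; chunk p0005 L118–127)] -/
theorem mem_cosetGeneralizedWeightsSet_iff (p : (Σ m : ℕ, Σ n : ℕ, (Fin m → SympVec n) × (Fin m → ZMod 2)) × ℕ) :
    p ∈ cosetGeneralizedWeightsSet ↔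
      IsSelfOrthogonal (rowSpan p.1.2.2.1) ∧
        ∃ e : SympVec p.1.2.1, sympSyndrome p.1.2.2.1 e = p.1.2.2.2 ∧ sympWeight e ≤ p.2 :=
  Iff.rfl

/-- The yes-set is monotone in the weight bound `t` (so the least yes-`t` is the minimum weight of an
error with the given syndrome — bounded-distance decoding by «successively» asking CGW).
[cite: KuoLu2020, §3 (QBDD vs. CGW; chunk p0005 L48–66, L116–127)] -/
theorem cosetGeneralizedWeightsSet_mono {I : Σ m : ℕ, Σ n : ℕ, (Fin m → SympVec n) × (Fin m → ZMod 2)}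
    {t t' : ℕ} (ht : t ≤ t') (h : (I, t) ∈ cosetGeneralizedWeightsSet) : (I, t') ∈ cosetGeneralizedWeightsSet := by
  obtain ⟨hS, e, he, hw⟩ := h
  exact ⟨hS, e, he, hw.trans ht⟩

/-- **The language CGW** (COSET GENERALIZED WEIGHTS) over `{0,1}`: codes `⟨code ⟨m, n, H, s⟩, bin t⟩`
of the members of `cosetGeneralizedWeightsSet`. [cite: KuoLu2020, §3 (problem CGW; chunk p0005 L118–127)] -/
def CGW : Language Bool :=
  (encodingSyndInstance.pairBool encodingNatBool).toLanguage cosetGeneralizedWeightsSet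

/-- Yes-instances of the restricted problem `CGW_Z`: yes-instances of CGW whose check matrix is
`H = [O|H_Z]`, i.e. every row is a Z-type check `(0|b)`.
[cite: KuoLu2020, §3 (problem CGW_Z; chunk p0005 L135–150)] -/
def cosetGeneralizedWeightsZSet : Set ((Σ m : ℕ, Σ n : ℕ, (Fin m → SympVec n) × (Fin m → ZMod 2)) × ℕ) :=
  {p | (∀ i, (p.1.2.2.1 i).1 = 0) ∧ p ∈ cosetGeneralizedWeightsSet}

/-- **The language CGW_Z** over `{0,1}` (instances with `H = [O|H_Z]`).
[cite: KuoLu2020, §3 (problem CGW_Z; chunk p0005 L135–150)] -/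
def CGWZ : Language Bool :=
  (encodingSyndInstance.pairBool encodingNatBool).toLanguage cosetGeneralizedWeightsZSet

/-- `CGW_Z ⊆ CGW` (a restriction of the input). [cite: KuoLu2020, §3 (chunk p0005 L135–141: «we say that CGW becomes a restricted problem CGW_Z»)] -/
theorem CGWZ_le_CGW : CGWZ ≤ CGW :=
  Computability.Encoding.toLanguage_mono _ fun _ hp => hp.2

namespace SynDecHard

open CSSDistHard

variable {m n : ℕ} (A : Fin m → Fin n → ZMod 2) (y : Fin n → ZMod 2)

/-! ### The Z-type check matrix of a COSET WEIGHTS instance -/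

/-- **The check matrix `[O | Aᵀ]`**: one Z-type row `(0 | A eⱼ)` (the `j`-th column of `A`) per
column `j < n` of the COSET WEIGHTS matrix `A ∈ 𝔽₂^{m × n}`, on `m` qubits.
[cite: KuoLu2020, §3 (CGW_Z: H = [O|H_Z]; chunk p0005 L135–150)] -/
def zRows (A : Fin m → Fin n → ZMod 2) : Fin n → SympVec m := fun j => ((0, fun i => A i j) : SympVec m)

/-- Every row of `[O | Aᵀ]` is Z-type. [cite: KuoLu2020, §3 (H = [O|H_Z]; chunk p0005 L135–141)] -/
theorem zRows_fst (j : Fin n) : (zRows A j).1 = 0 := rfl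

/-- Z-type rows pairwise commute: `[O|H_Z] Λ [O|H_Z]ᵀ = O`.
[cite: KuoLu2020, §3 (chunk p0006 L7: «an H = [O|H_Z] already satisfies HΛHᵀ = O»)] -/
theorem isSelfOrthogonal_rowSpan_zRows : IsSelfOrthogonal (rowSpan (zRows A)) := by
  unfold rowSpan
  rw [isSelfOrthogonal_span_range_iff]
  intro i j
  simp [zRows, sympInner]

/-- **The syndrome of `e = (x|z)` for the check matrix `[O | Aᵀ]` is `x A`** (the Z-checks see only
the X-part). [cite: KuoLu2020, §3 (chunk p0005 L40–46: «s = φ(E) Λ Hᵀ … a classical binary syndrome vector»)] -/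
theorem sympSyndrome_zRows (e : SympVec m) : sympSyndrome (zRows A) e = Matrix.vecMul e.1 (Matrix.of A) := by
  funext j
  simp only [sympSyndrome_apply, zRows, sympInner, zero_dotProduct, zero_add]
  rfl

/-- **The CGW instance** of the COSET WEIGHTS instance `(A, y, w)`: check matrix `[O | Aᵀ]` (`n` rows,
`m` qubits), syndrome `y`, bound `min(w, m)`.
[cite: KuoLu2020, §3 (CGW_Z; chunk p0005 L135–150)] -/
def zInst (m n : ℕ) (A : Fin m → Fin n → ZMod 2) (y : Fin n → ZMod 2) (w : ℕ) :
    (Σ r : ℕ, Σ n' : ℕ, (Fin r → SympVec n') × (Fin r → ZMod 2)) × ℕ :=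
  (⟨n, m, (zRows A, y)⟩, min w m)

/-- **The CGW instance is a YES instance iff `(A, y, w)` is a YES instance of COSET WEIGHTS**: an
error `e = (x|z)` of weight `≤ min(w,m)` with syndrome `y` has `wt(x) ≤ gw(e) ≤ w` and `x A = y`;
conversely `e = (x|0)` has `gw(e) = wt(x) ≤ min(w, m)`.
[cite: KuoLu2020, §3 (Theorem «CGW is NP-complete, even if … H = [O|H_Z]», chunk p0005 L129–134; §2 eq. gw ≥ max(w_H(x), w_H(z)), chunk p0004 L133–135)] -/
theorem zInst_mem_iff (w : ℕ) :
    zInst m n A y w ∈ cosetGeneralizedWeightsSet ↔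
      ((⟨m, n, (A, y)⟩ : Σ m : ℕ, Σ n : ℕ, (Fin m → Fin n → ZMod 2) × (Fin n → ZMod 2)), w) ∈ cosetWeightsSet := by
  rw [mem_cosetWeightsSet_iff]
  change (IsSelfOrthogonal (rowSpan (zRows A)) ∧
      ∃ e : SympVec m, sympSyndrome (zRows A) e = y ∧ sympWeight e ≤ min w m) ↔
    ∃ x : Fin m → ZMod 2, hammingNorm x ≤ w ∧ Matrix.vecMul x (Matrix.of A) = y
  constructor
  · rintro ⟨-, e, he, hw⟩
    refine ⟨e.1, ?_, by rwa [← sympSyndrome_zRows]⟩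
    exact ((CSSDistHard.hammingNorm_fst_le_sympWeight e).trans hw).trans (Nat.min_le_left _ _)
  · rintro ⟨x, hx, hxA⟩
    refine ⟨isSelfOrthogonal_rowSpan_zRows A, ((x, 0) : SympVec m), by rw [sympSyndrome_zRows, ← hxA], ?_⟩
    rw [sympWeight_mk_zero_snd]
    exact le_min hx ((hammingNorm_le_card_fintype).trans_eq (Fintype.card_fin m))

/-- The CGW instance is a `CGW_Z` instance (all rows Z-type), so it is a YES instance of `CGW_Z` iff
`(A, y, w)` is a YES instance of COSET WEIGHTS. [cite: KuoLu2020, §3 (CGW_Z; chunk p0005 L135–150)] -/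
theorem zInst_memZ_iff (w : ℕ) :
    zInst m n A y w ∈ cosetGeneralizedWeightsZSet ↔
      ((⟨m, n, (A, y)⟩ : Σ m : ℕ, Σ n : ℕ, (Fin m → Fin n → ZMod 2) × (Fin n → ZMod 2)), w) ∈ cosetWeightsSet := by
  rw [← zInst_mem_iff A y w]
  exact ⟨fun h => h.2, fun h => ⟨fun j => zRows_fst A j, h⟩⟩


/-! ### The instance written by the machine -/

/-- Row `t` of `[O | Aᵀ]`, X-part, as a bit string: `0^m`. [cite: KuoLu2020, §3 (H = [O|H_Z]; chunk p0005 L135–141)] -/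
def aRowBits (m : ℕ) : List Bool := List.ofFn fun _ : Fin m => false

/-- Row `t` of `[O | Aᵀ]`, Z-part, as a bit string: column `t` of `A` read off the bit table of `x`.
[cite: KuoLu2020, §3 (H = [O|H_Z]; chunk p0005 L135–141)] -/
def bRowBits (x : List Bool) (m t : ℕ) : List Bool := List.ofFn fun u : Fin m => Abits x u t

/-- The syndrome bits `y₀ … y_{n-1}` read off `x`. [cite: KuoLu2020, §3 (problem CGW, Input s; chunk p0005 L118–124)] -/
def sBits (x : List Bool) (n : ℕ) : List Bool := List.ofFn fun t : Fin n => ybits x t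

/-- **The CGW instance written from the string `x`** (size parameters `m, n`): the instance `zInst` of
the matrices read off the bit tables of `x`. [cite: KuoLu2020, §3 (CGW_Z; chunk p0005 L135–150)] -/
def strInstS (x : List Bool) (m n : ℕ) : (Σ r : ℕ, Σ n' : ℕ, (Fin r → SympVec n') × (Fin r → ZMod 2)) × ℕ :=
  zInst m n (matOfBits (Abits x) m n) (vecOfBits (ybits x) n) (CosetWeightsNP.wOf x)

/-- **On a code, the string instance is a YES instance of CGW iff the coded COSET WEIGHTS instance is a
YES instance.** [cite: KuoLu2020, §3 (Theorem «CGW is NP-complete, even if … H = [O|H_Z]»; chunk p0005 L129–134)] -/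
theorem strInstS_mem_iff (x : List Bool) :
    strInstS x (CosetWeightsNP.mOf x) (CosetWeightsNP.nOf x) ∈ cosetGeneralizedWeightsSet ↔
      CosetWeightsNP.instOf x ∈ cosetWeightsSet := by
  rw [strInstS, zInst_mem_iff]
  rfl

/-- The same for `CGW_Z`. [cite: KuoLu2020, §3 (CGW_Z; chunk p0005 L135–150)] -/
theorem strInstS_memZ_iff (x : List Bool) :
    strInstS x (CosetWeightsNP.mOf x) (CosetWeightsNP.nOf x) ∈ cosetGeneralizedWeightsZSet ↔
      CosetWeightsNP.instOf x ∈ cosetWeightsSet := by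
  rw [strInstS, zInst_memZ_iff]
  rfl

/-! ### A fixed NO instance -/

/-- A fixed NO instance: one (empty) check row on zero qubits with syndrome bit `1`. [folklore] -/
def badS : (Σ r : ℕ, Σ n' : ℕ, (Fin r → SympVec n') × (Fin r → ZMod 2)) × ℕ := (⟨1, 0, (fun _ => 0, fun _ => 1)⟩, 0)

/-- The NO instance is a no-instance of CGW (every error has syndrome `0 ≠ 1`). [folklore] -/
private theorem badS_not_mem : badS ∉ cosetGeneralizedWeightsSet := by
  rintro ⟨-, e, he, -⟩
  change sympSyndrome (fun _ : Fin 1 => (0 : SympVec 0)) e = fun _ => 1 at he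
  have h := congr_fun he 0
  have h0 : sympInner (0 : SympVec 0) e = 0 := by simp [sympInner]
  rw [sympSyndrome_apply, h0] at h
  exact absurd h (by decide)

/-- The NO instance is a no-instance of `CGW_Z`. [folklore] -/
private theorem badS_not_memZ : badS ∉ cosetGeneralizedWeightsZSet := fun h => badS_not_mem h.2

/-! ### The machine: bricks -/

open Polynomial Brick HashBricks Plumb
open Literature.InformationTheory.Coding.CosetWeightsNP (mhat nhat)

/-- Value of `mhatF` (re-proved; private upstream). [folklore] -/
private theorem mhatF_apply (x : List Bool) : CosetWeightsNP.mhatF x = ones (mhat x) := by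
  rw [CosetWeightsNP.mhatF, Function.comp_apply, fanoutFn_apply, binToUnaryFn_boolPair]; rfl

/-- Value of `nhatF` (re-proved; private upstream). [folklore] -/
private theorem nhatF_apply (x : List Bool) : CosetWeightsNP.nhatF x = ones (nhat x) := by
  rw [CosetWeightsNP.nhatF, Function.comp_apply, fanoutFn_apply, binToUnaryFn_boolPair]; rfl

/-- Value of `itemF` (re-proved; private upstream). [folklore] -/
private theorem itemF_apply (x : List Bool) (t : ℕ) :
    CosetWeightsNP.itemF (boolPair x (ones t)) = CosetWeightsNP.item x t := by
  rw [CosetWeightsNP.itemF, Function.comp_apply, fanoutFn_apply, sndF_boolPair, Function.comp_apply, fstF_boolPair,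
    nthItemFn_boolPair, List.length_replicate]; rfl

/-- `mhat ≤ |x|`. [folklore] -/
private theorem mhat_le (x : List Bool) : mhat x ≤ x.length := Nat.min_le_right _ _

/-- `nhat ≤ |x|`. [folklore] -/
private theorem nhat_le (x : List Bool) : nhat x ≤ x.length := Nat.min_le_right _ _

/-- On the entry record `⟨⟨x, 1ᵗ⟩, 1ᵘ⟩`: row `u` of the COSET WEIGHTS matrix (`item x u`). [folklore] -/
def itemU : List Bool → List Bool := CosetWeightsNP.itemF ∘ fanoutFn zX sndF
/-- **The Z-part entry function**: on `⟨⟨x, 1ᵗ⟩, 1ᵘ⟩`, the bit `A u t` (check row `t`, qubit `u`).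
[cite: KuoLu2020, §3 (H = [O|H_Z]; chunk p0005 L135–141)] -/
def bbitS : List Bool → List Bool := headBitFn ∘ bitAtFn ∘ fanoutFn zT itemU
/-- **The syndrome bit function**: on `⟨x, 1ᵗ⟩`, the bit `y t`. [cite: KuoLu2020, §3 (Input s; chunk p0005 L118–124)] -/
def sbitS : List Bool → List Bool := headBitFn ∘ bitAtFn ∘ fanoutFn sndF (CosetWeightsNP.yvF ∘ fstF)

/-- `itemU ∈ FP`. [cite: AroraBarak2009, §1.3 (polynomial time is closed under composition)] -/
theorem itemU_mem_FP : itemU ∈ FP := comp_mem_FP CosetWeightsNP.itemF_mem_FP (fanoutFn_mem_FP zX_mem_FP sndF_mem_FP)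
/-- `bbitS ∈ FP`. [cite: AroraBarak2009, §1.3 (polynomial time is closed under composition)] -/
theorem bbitS_mem_FP : bbitS ∈ FP :=
  comp_mem_FP headBitFn_mem_FP (comp_mem_FP bitAtFn_mem_FP (fanoutFn_mem_FP zT_mem_FP itemU_mem_FP))
/-- `sbitS ∈ FP`. [cite: AroraBarak2009, §1.3 (polynomial time is closed under composition)] -/
theorem sbitS_mem_FP : sbitS ∈ FP :=
  comp_mem_FP headBitFn_mem_FP (comp_mem_FP bitAtFn_mem_FP
    (fanoutFn_mem_FP sndF_mem_FP (comp_mem_FP CosetWeightsNP.yvF_mem_FP fstF_mem_FP)))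

section EntryValues

variable (x : List Bool) (t u : ℕ)

/-- Value of `itemU`. [folklore] -/
private theorem itemU_rec : itemU (CSSDistHard.rec x t u) = CosetWeightsNP.item x u := by
  rw [itemU, Function.comp_apply, fanoutFn_apply]
  simp only [CSSDistHard.rec, zX, Function.comp_apply, fstF_boolPair, sndF_boolPair]
  exact itemF_apply x u

/-- **Value of the Z-part entry function**: `[A u t]`. [cite: KuoLu2020, §3 (H = [O|H_Z]; chunk p0005 L135–141)] -/
theorem bbitS_rec : bbitS (CSSDistHard.rec x t u) = [Abits x u t] := by
  rw [bbitS, Function.comp_apply, Function.comp_apply, fanoutFn_apply, itemU_rec]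
  simp only [CSSDistHard.rec, zT, Function.comp_apply, fstF_boolPair, sndF_boolPair]
  rw [bitAtFn_boolPair, List.length_replicate, headBitFn_apply, ThreeDMNP.headD_take_drop]
  rfl

/-- **Value of the syndrome bit function**: `[y t]`. [cite: KuoLu2020, §3 (Input s; chunk p0005 L118–124)] -/
theorem sbitS_apply : sbitS (boolPair x (ones t)) = [ybits x t] := by
  rw [sbitS, Function.comp_apply, Function.comp_apply, fanoutFn_apply, sndF_boolPair, Function.comp_apply, fstF_boolPair,
    bitAtFn_boolPair, List.length_replicate, headBitFn_apply, ThreeDMNP.headD_take_drop]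
  rfl

end EntryValues

/-! ### The machine: rows, syndrome and the instance -/

/-- X-part of a row: `0^m`, as a fold of the constant `[false]` over `u < m` on `⟨x, 1ᵗ⟩`. [cite: AroraBarak2009, §1.3 (bounded loops)] -/
def aRowS : List Bool → List Bool := foldCat 1 X (fun _ => [false]) ∘ fanoutFn id (CosetWeightsNP.mhatF ∘ fstF)
/-- Z-part of row `t`: fold of `bbitS` over `u < m` on `⟨x, 1ᵗ⟩`. [cite: AroraBarak2009, §1.3 (bounded loops)] -/
def bRowS : List Bool → List Bool := foldCat 1 X bbitS ∘ fanoutFn id (CosetWeightsNP.mhatF ∘ fstF)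
/-- The framed row `⟨⟨a, b⟩, ε⟩`. [cite: AroraBarak2009, §0.1] -/
def frameS : List Bool → List Bool := fanoutFn (fanoutFn aRowS bRowS) (fun _ => [])
/-- **The rows**: fold of the framed rows over `t < n`. [cite: AroraBarak2009, §1.3 (bounded loops)] -/
def rowsS : List Bool → List Bool := foldCat (6 * X + 6) X frameS ∘ fanoutFn id CosetWeightsNP.nhatF
/-- **The syndrome**: fold of `sbitS` over `t < n`. [cite: AroraBarak2009, §1.3 (bounded loops)] -/
def sRowS : List Bool → List Bool := foldCat 1 X sbitS ∘ fanoutFn id CosetWeightsNP.nhatF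
/-- The instance proper `⟨bin n, ⟨bin m, ⟨⟨1ⁿ, rows⟩, s⟩⟩⟩`. [cite: KuoLu2020, §3 (problem CGW, Input; chunk p0005 L118–124)] -/
def instS : List Bool → List Bool :=
  fanoutFn (lenBinF ∘ CosetWeightsNP.nhatF) (fanoutFn (lenBinF ∘ CosetWeightsNP.mhatF)
    (fanoutFn (fanoutFn CosetWeightsNP.nhatF rowsS) sRowS))
/-- The bound `bin (min(w, m))`. [cite: KuoLu2020, §3 (problem CGW, Input t; chunk p0005 L118–124)] -/
def tS : List Bool → List Bool := lenBinF ∘ binToUnaryFn ∘ fanoutFn CosetWeightsNP.mhatF sndF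
/-- **The map on genuine arguments**: `⟨instance, bin (min(w, m))⟩`. [cite: KuoLu2020, §3 (CGW_Z; chunk p0005 L135–150)] -/
def goodS : List Bool → List Bool := fanoutFn instS tS

/-- `aRowS ∈ FP`. [cite: AroraBarak2009, §1.3 (polynomial time is closed under composition and bounded loops)] -/
theorem aRowS_mem_FP : aRowS ∈ FP :=
  comp_mem_FP (foldCat_mem_FP _ _ (const_mem_FP _))
    (fanoutFn_mem_FP OracleCompose.id_mem_FP (comp_mem_FP CosetWeightsNP.mhatF_mem_FP fstF_mem_FP))
/-- `bRowS ∈ FP`. [cite: AroraBarak2009, §1.3 (polynomial time is closed under composition and bounded loops)] -/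
theorem bRowS_mem_FP : bRowS ∈ FP :=
  comp_mem_FP (foldCat_mem_FP _ _ bbitS_mem_FP)
    (fanoutFn_mem_FP OracleCompose.id_mem_FP (comp_mem_FP CosetWeightsNP.mhatF_mem_FP fstF_mem_FP))
/-- `frameS ∈ FP`. [cite: AroraBarak2009, §1.3 (polynomial time is closed under composition)] -/
theorem frameS_mem_FP : frameS ∈ FP := fanoutFn_mem_FP (fanoutFn_mem_FP aRowS_mem_FP bRowS_mem_FP) (const_mem_FP _)
/-- `rowsS ∈ FP`. [cite: AroraBarak2009, §1.3 (polynomial time is closed under composition and bounded loops)] -/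
theorem rowsS_mem_FP : rowsS ∈ FP :=
  comp_mem_FP (foldCat_mem_FP _ _ frameS_mem_FP) (fanoutFn_mem_FP OracleCompose.id_mem_FP CosetWeightsNP.nhatF_mem_FP)
/-- `sRowS ∈ FP`. [cite: AroraBarak2009, §1.3 (polynomial time is closed under composition and bounded loops)] -/
theorem sRowS_mem_FP : sRowS ∈ FP :=
  comp_mem_FP (foldCat_mem_FP _ _ sbitS_mem_FP) (fanoutFn_mem_FP OracleCompose.id_mem_FP CosetWeightsNP.nhatF_mem_FP)
/-- `instS ∈ FP`. [cite: AroraBarak2009, §1.3 (polynomial time is closed under composition)] -/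
theorem instS_mem_FP : instS ∈ FP :=
  fanoutFn_mem_FP (comp_mem_FP lenBinF_mem_FP CosetWeightsNP.nhatF_mem_FP)
    (fanoutFn_mem_FP (comp_mem_FP lenBinF_mem_FP CosetWeightsNP.mhatF_mem_FP)
      (fanoutFn_mem_FP (fanoutFn_mem_FP CosetWeightsNP.nhatF_mem_FP rowsS_mem_FP) sRowS_mem_FP))
/-- `tS ∈ FP`. [cite: AroraBarak2009, §1.3 (polynomial time is closed under composition)] -/
theorem tS_mem_FP : tS ∈ FP :=
  comp_mem_FP lenBinF_mem_FP (comp_mem_FP binToUnaryFn_mem_FP (fanoutFn_mem_FP CosetWeightsNP.mhatF_mem_FP sndF_mem_FP))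
/-- **`goodS ∈ FP`.** [cite: AroraBarak2009, §1.3 (polynomial time is closed under composition and bounded loops)] -/
theorem goodS_mem_FP : goodS ∈ FP := fanoutFn_mem_FP instS_mem_FP tS_mem_FP

section RowValues

variable (x : List Bool)

/-- **Value of `aRowS`.** [cite: KuoLu2020, §3 (H = [O|H_Z]; chunk p0005 L135–141)] -/
theorem aRowS_apply (t : ℕ) : aRowS (boolPair x (ones t)) = aRowBits (mhat x) := by
  rw [aRowS, Function.comp_apply, fanoutFn_apply, Function.comp_apply, fstF_boolPair, mhatF_apply, id,
    foldCat_apply (by rw [List.length_replicate, eval_X, length_boolPair]; have := mhat_le x; omega)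
      (fun u _ => by rw [eval_one, List.length_singleton]), List.length_replicate]
  exact ThreeDM.ccat_single_eq_ofFn (fun _ => false) _

/-- **Value of `bRowS`.** [cite: KuoLu2020, §3 (H = [O|H_Z]; chunk p0005 L135–141)] -/
theorem bRowS_apply (t : ℕ) : bRowS (boolPair x (ones t)) = bRowBits x (mhat x) t := by
  have hb : ∀ u, bbitS (boolPair (boolPair x (ones t)) (ones u)) = [Abits x u t] := fun u => bbitS_rec x t u
  rw [bRowS, Function.comp_apply, fanoutFn_apply, Function.comp_apply, fstF_boolPair, mhatF_apply, id,
    foldCat_apply (by rw [List.length_replicate, eval_X, length_boolPair]; have := mhat_le x; omega)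
      (fun u _ => by rw [eval_one, hb, List.length_singleton]), List.length_replicate]
  simp only [hb]
  exact ThreeDM.ccat_single_eq_ofFn _ _

/-- **Value of `frameS`.** [cite: AroraBarak2009, §0.1] -/
theorem frameS_apply (t : ℕ) :
    frameS (boolPair x (ones t)) = boolPair (boolPair (aRowBits (mhat x)) (bRowBits x (mhat x) t)) [] := by
  rw [frameS, fanoutFn_apply, fanoutFn_apply, aRowS_apply, bRowS_apply]

/-- **Value of `rowsS`**: the framed row codes. [cite: AroraBarak2009, §0.1] -/
theorem rowsS_apply :
    rowsS x = ccat (fun t => boolPair (boolPair (aRowBits (mhat x)) (bRowBits x (mhat x) t)) []) (nhat x) := by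
  rw [rowsS, Function.comp_apply, fanoutFn_apply, nhatF_apply, id,
    foldCat_apply (by rw [List.length_replicate, eval_X]; exact nhat_le x)
      (fun t _ => by
        rw [frameS_apply, length_boolPair, length_boolPair, aRowBits, bRowBits, List.length_ofFn, List.length_ofFn,
          List.length_nil, eval_add, eval_mul, eval_ofNat, eval_X]
        have := mhat_le x
        omega), List.length_replicate]
  exact ccat_congr fun t _ => frameS_apply x t

/-- **Value of `sRowS`**: the syndrome bits. [cite: KuoLu2020, §3 (Input s; chunk p0005 L118–124)] -/
theorem sRowS_apply : sRowS x = sBits x (nhat x) := by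
  have hb : ∀ t, sbitS (boolPair x (ones t)) = [ybits x t] := fun t => sbitS_apply x t
  rw [sRowS, Function.comp_apply, fanoutFn_apply, nhatF_apply, id,
    foldCat_apply (by rw [List.length_replicate, eval_X]; exact nhat_le x)
      (fun t _ => by rw [eval_one, hb, List.length_singleton]), List.length_replicate]
  simp only [hb]
  exact ThreeDM.ccat_single_eq_ofFn _ _

/-- **Value of `tS`**: `bin (min(w, m))`. [cite: KuoLu2020, §3 (Input t; chunk p0005 L118–124)] -/
theorem tS_apply : tS x = encodeNat (min (CosetWeightsNP.wOf x) (mhat x)) := by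
  rw [tS, Function.comp_apply, Function.comp_apply, fanoutFn_apply, mhatF_apply, binToUnaryFn_boolPair, lenBinF_apply,
    List.length_replicate, List.length_replicate]
  rfl

end RowValues

/-! ### The code of the instance -/

/-- The framed body of a list code is the concatenation of one-item frames (re-proved; not in the cone). [folklore] -/
private theorem frames_ofFn_eq_ccat (c : ℕ → List Bool) (k : ℕ) :
    frames (List.ofFn fun i : Fin k => c i) = ccat (fun i => boolPair (c i) []) k := by
  rw [frames_ofFn]
  exact ccat_congr fun i _ => by rw [boolPair_eq, List.append_nil]

/-- The code of a row of bits given by a Boolean table. [cite: AroraBarak2009, §0.1] -/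
private theorem encode_boolRow {K : ℕ} (g : Fin K → Bool) :
    (encodingF2Vec K).encode (fun u => if g u then (1 : ZMod 2) else 0) = List.ofFn g := by
  show (List.ofFn fun u : Fin K => decide ((if g u then (1 : ZMod 2) else 0) = 1)) = _
  congr 1
  funext u
  cases g u <;> decide

/-- The code of the zero row. [cite: AroraBarak2009, §0.1] -/
private theorem encode_zeroRow (K : ℕ) : (encodingF2Vec K).encode (0 : Fin K → ZMod 2) = aRowBits K := by
  show (List.ofFn fun u : Fin K => decide ((0 : Fin K → ZMod 2) u = 1)) = _
  rfl

/-- The code of the machine's check matrix `[O | Aᵀ]`. [cite: AroraBarak2009, §0.1] -/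
theorem encode_zRows (x : List Bool) (m n : ℕ) :
    (encodingFinVec ((encodingF2Vec m).pairBool (encodingF2Vec m)) n).encode (zRows (matOfBits (Abits x) m n)) =
      boolPair (ones n) (ccat (fun t => boolPair (boolPair (aRowBits m) (bRowBits x m t)) []) n) := by
  rw [finVec_encode_eq, boolPair_eq, OracleCompose.unaryEncodeNat_eq_replicate, ← frames_ofFn_eq_ccat]
  congr 2
  refine List.ofFn_inj.2 (funext fun t => ?_)
  show boolPair ((encodingF2Vec _).encode _) ((encodingF2Vec _).encode _) = _
  rw [zRows, encode_zeroRow]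
  congr 1
  exact encode_boolRow fun u : Fin m => Abits x u t

/-- The code of the machine's syndrome. [cite: AroraBarak2009, §0.1] -/
theorem encode_sVec (x : List Bool) (n : ℕ) : (encodingF2Vec n).encode (vecOfBits (ybits x) n) = sBits x n :=
  encode_boolRow fun t : Fin n => ybits x t

/-- **The code of the string instance.** [cite: AroraBarak2009, §0.1] -/
theorem encode_strInstS (x : List Bool) (m n : ℕ) :
    (encodingSyndInstance.pairBool encodingNatBool).encode (strInstS x m n) =
      boolPair (boolPair (encodeNat n) (boolPair (encodeNat m) (boolPair
        ((encodingFinVec ((encodingF2Vec m).pairBool (encodingF2Vec m)) n).encode (zRows (matOfBits (Abits x) m n)))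
        ((encodingF2Vec n).encode (vecOfBits (ybits x) n)))))
        (encodeNat (min (CosetWeightsNP.wOf x) m)) :=
  rfl

/-- **On any input `goodS` outputs the code of the string instance with the clamped sizes.**
[cite: KuoLu2020, §3 (CGW_Z; chunk p0005 L135–150)] -/
theorem goodS_apply (x : List Bool) :
    goodS x = (encodingSyndInstance.pairBool encodingNatBool).encode (strInstS x (mhat x) (nhat x)) := by
  rw [encode_strInstS, encode_zRows, encode_sVec, goodS, fanoutFn_apply, instS, fanoutFn_apply, fanoutFn_apply,
    fanoutFn_apply, fanoutFn_apply, Function.comp_apply, nhatF_apply, lenBinF_apply, List.length_replicate,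
    Function.comp_apply, mhatF_apply, lenBinF_apply, List.length_replicate, rowsS_apply, sRowS_apply, tS_apply]

/-! ### The reduction -/

/-- **The reduction function** `COSETWEIGHTS → CGW` (with image inside the `CGW_Z` instances).
[cite: KuoLu2020, §3 (Theorem «CGW is NP-complete, even if … H = [O|H_Z]»; chunk p0005 L129–134)] -/
def outS : List Bool → List Bool :=
  iteFn CosetWeightsNP.T goodS (fun _ => (encodingSyndInstance.pairBool encodingNatBool).encode badS)

/-- **`outS ∈ FP`.** [cite: AroraBarak2009, §1.3] -/
theorem outS_mem_FP : outS ∈ FP := iteFn_mem_FP CosetWeightsNP.T_mem_FP goodS_mem_FP (const_mem_FP _)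

/-- On a good shape the clamps are off (re-proved; private upstream). [folklore] -/
private theorem clamps_of_goodShape {x : List Bool} (h : CosetWeightsNP.GoodShape x) :
    mhat x = CosetWeightsNP.mOf x ∧ nhat x = CosetWeightsNP.nOf x := by
  obtain ⟨hx, hy, -⟩ := h
  have hlen := congrArg List.length hx
  simp only [CosetWeightsNP.reb, length_boolPair, List.length_replicate] at hlen
  unfold CosetWeightsNP.mhat CosetWeightsNP.nhat at *
  omega

/-- Under the guard, the output is the code of the string instance with the true sizes. [folklore] -/
private theorem outS_of_guard {x : List Bool} (h : CosetWeightsNP.T x = [true]) :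
    outS x = (encodingSyndInstance.pairBool encodingNatBool).encode
      (strInstS x (CosetWeightsNP.mOf x) (CosetWeightsNP.nOf x)) := by
  obtain ⟨hm, hn⟩ := clamps_of_goodShape ((CosetWeightsNP.T_eq_true_iff x).1 h)
  rw [outS, iteFn_apply_true h, goodS_apply, hm, hn]

/-- Under the guard, membership of the input in COSET WEIGHTS is membership of the decoded instance. [folklore] -/
private theorem mem_COSETWEIGHTS_iff_of_guard {x : List Bool} (h : CosetWeightsNP.T x = [true]) :
    x ∈ COSETWEIGHTS ↔ CosetWeightsNP.instOf x ∈ cosetWeightsSet := by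
  have hG : CosetWeightsNP.GoodShape x := (CosetWeightsNP.T_eq_true_iff x).1 h
  conv_lhs => rw [← CosetWeightsNP.encode_instOf hG]
  exact Computability.Encoding.mem_toLanguage_iff _ _ _

/-- **Under the guard, the input is a YES instance of COSET WEIGHTS iff the output is a YES instance of
CGW.** [cite: KuoLu2020, §3 (Theorem, chunk p0005 L129–134)] -/
theorem mem_iff_of_guard {x : List Bool} (h : CosetWeightsNP.T x = [true]) : x ∈ COSETWEIGHTS ↔ outS x ∈ CGW := by
  rw [mem_COSETWEIGHTS_iff_of_guard h, outS_of_guard h, CGW, Computability.Encoding.mem_toLanguage_iff, strInstS_mem_iff]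

/-- **Under the guard, the input is a YES instance of COSET WEIGHTS iff the output is a YES instance of
`CGW_Z`.** [cite: KuoLu2020, §3 (Theorem, clause «even if H = [O|H_Z]»; chunk p0005 L129–134)] -/
theorem memZ_iff_of_guard {x : List Bool} (h : CosetWeightsNP.T x = [true]) : x ∈ COSETWEIGHTS ↔ outS x ∈ CGWZ := by
  rw [mem_COSETWEIGHTS_iff_of_guard h, outS_of_guard h, CGWZ, Computability.Encoding.mem_toLanguage_iff, strInstS_memZ_iff]

/-- Off the guard the output is the NO instance. [folklore] -/
private theorem outS_of_not_guard {x : List Bool} (h : ¬ CosetWeightsNP.T x = [true]) :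
    outS x = (encodingSyndInstance.pairBool encodingNatBool).encode badS := by
  rw [outS, iteFn_of_oneBit CosetWeightsNP.oneBit_T, if_neg h]

/-- Off the guard the input is not a code of COSET WEIGHTS. [folklore] -/
private theorem not_mem_of_not_guard {x : List Bool} (h : ¬ CosetWeightsNP.T x = [true]) : x ∉ COSETWEIGHTS := by
  rintro ⟨I, -, rfl⟩
  exact h ((CosetWeightsNP.T_eq_true_iff _).2 (CosetWeightsNP.goodShape_encode I))

/-- **COSET WEIGHTS `≤ₚ` CGW**: the polynomial-time map `outS` sends the code of `(A, y, w)` to the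
code of `([O | Aᵀ], y, min(w, m))` — a YES instance iff `(A, y, w)` is (`zInst_mem_iff`) — and every
other string to a NO instance. This is the identification «CGW_Z = classical coset decoding» of the
printed proof. [cite: KuoLu2020, §3 (Theorem «CGW is NP-complete, even if …»; chunk p0005 L129–134)] -/
theorem COSETWEIGHTS_karpReducible_CGW : COSETWEIGHTS ≤ₚ CGW := by
  refine ⟨outS, outS_mem_FP, fun x => ?_⟩
  show x ∈ COSETWEIGHTS ↔ outS x ∈ CGW
  by_cases hg : CosetWeightsNP.T x = [true]
  · exact mem_iff_of_guard hg
  · refine ⟨fun hx => absurd hx (not_mem_of_not_guard hg), fun hx => ?_⟩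
    rw [outS_of_not_guard hg] at hx
    exact absurd ((Computability.Encoding.mem_toLanguage_iff _ _ _).1 hx) badS_not_mem

/-- **COSET WEIGHTS `≤ₚ` CGW_Z** (the same map; its image consists of Z-type instances).
[cite: KuoLu2020, §3 (Theorem, clause «even if H = [O|H_Z]»; chunk p0005 L129–134)] -/
theorem COSETWEIGHTS_karpReducible_CGWZ : COSETWEIGHTS ≤ₚ CGWZ := by
  refine ⟨outS, outS_mem_FP, fun x => ?_⟩
  show x ∈ COSETWEIGHTS ↔ outS x ∈ CGWZ
  by_cases hg : CosetWeightsNP.T x = [true]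
  · exact memZ_iff_of_guard hg
  · refine ⟨fun hx => absurd hx (not_mem_of_not_guard hg), fun hx => ?_⟩
    rw [outS_of_not_guard hg] at hx
    exact absurd ((Computability.Encoding.mem_toLanguage_iff _ _ _).1 hx) badS_not_memZ

end SynDecHard

/-- **Kuo–Lu 2020 §3 / Fujita 2012 Lemma 2, NP-hardness half with the clause «even if H = [O|H_Z]»:
`CGW_Z` is NP-hard** — deciding whether a syndrome of a Z-type check matrix is explained by a Pauli
error of generalized weight `≤ t` is NP-hard (KERNEL: `BerlekampMcElieceVanTilborg1978_cosetWeights_isNPHard`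
transported along `SynDecHard.COSETWEIGHTS_karpReducible_CGWZ`).
[cite: KuoLu2020, §3 Theorem «CGW is NP-complete, even if H = [H_X|O] or H = [O|H_Z]» (arXiv:1306.5173 chunk p0005 L129–134), restating Fujita2012 Lemma 2] -/
theorem KuoLu2020_cosetGeneralizedWeightsZ_isNPHard : IsNPHard CGWZ :=
  IsHard.of_reducible_holds BerlekampMcElieceVanTilborg1978_cosetWeights_isNPHard
    SynDecHard.COSETWEIGHTS_karpReducible_CGWZ

/-- **Kuo–Lu 2020 §3 / Fujita 2012 Lemma 2, NP-hardness half: COSET GENERALIZED WEIGHTS is NP-hard** —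
minimum-weight (bounded-distance) syndrome decoding of a stabilizer code from its check matrix is
NP-hard (KERNEL; NP-membership, the other half of «NP-complete», is the sequel file's verifier).
[cite: KuoLu2020, §3 Theorem «CGW is NP-complete, even if H = [H_X|O] or H = [O|H_Z]» (arXiv:1306.5173 chunk p0005 L129–134), restating Fujita2012 Lemma 2] -/
theorem KuoLu2020_cosetGeneralizedWeights_isNPHard : IsNPHard CGW :=
  IsHard.of_reducible_holds BerlekampMcElieceVanTilborg1978_cosetWeights_isNPHard
    SynDecHard.COSETWEIGHTS_karpReducible_CGW

end Literature.InformationTheory.QuantumCodes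

end
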